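import Summits.HodgeConjecture.HodgeCM.Proofs.LandherrRankN_2

/-! PORT of `HodgeCM/Proofs/LandherrRankN.lean` (HodgeCMPerL run 82) — part 3: continuation of `Summits.HodgeConjecture.HodgeCM.Proofs.LandherrRankN_2` (split at a top-level declaration boundary by port_pkg.py; scope re-opened below; declarations unchanged). -/

-- port_pkg: scope re-opened for this part (file-level context, then the namespace/section stack open at the cut)
set_option autoImplicit false
noncomputable section
open NumberField
open scoped Matrix
namespace HodgeCM
open Literature.AlgebraicGeometry.ShimuraVarieties (conjRingHomK embedding_conjRingHomK)
namespace LandherrRankN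
variable (L : CMField)
section Main
variable {L}
/-- **Sufficiency.**  Two non-degenerate diagonal hermitian forms over `L` (entries in `L₀^×`) with the same
positive index at every complex embedding and the same discriminant class modulo norms are isometric. -/
theorem isomDiag_of_invariants : ∀ (n : ℕ) (ι : Type) [Fintype ι] [DecidableEq ι], Fintype.card ι = n →
    ∀ (a a' : ι → L), (∀ i, conjRingHomK L (a i) = a i) → (∀ i, conjRingHomK L (a' i) = a' i) →
    (∀ i, a i ≠ 0) → (∀ i, a' i ≠ 0) →
    (∀ τ : L →+* ℂ, posCount L τ a = posCount L τ a') →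
    (∃ z : L, z ≠ 0 ∧ ∏ i, a i = (∏ i, a' i) * (z * conjRingHomK L z)) → IsomDiag L a a' := by
  intro n
  induction n with
  | zero =>
    intro ι _ _ hcard a a' _ _ _ _ _ _
    haveI : IsEmpty ι := Fintype.card_eq_zero_iff.mp hcard
    exact IsomDiag.of_eq (funext fun i => isEmptyElim i)
  | succ n ih =>
    intro ι _ _ hcard a a' ha ha' ha0 ha'0 hsig hdisc
    rcases Nat.eq_zero_or_pos n with hn | hn
    · -- rank 1: `⟨a⟩ ≅ ⟨a'⟩` iff `a = a' · N(z)`, via `g = (z⁻¹)`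
      subst hn
      obtain ⟨i₀, hi₀⟩ := Fintype.card_eq_one_iff.mp hcard
      obtain ⟨z, hz, hprod⟩ := hdisc
      rw [Fintype.prod_eq_single i₀ fun x hx => absurd (hi₀ x) hx,
        Fintype.prod_eq_single i₀ fun x hx => absurd (hi₀ x) hx] at hprod
      have hσz : conjRingHomK L z ≠ 0 := (map_ne_zero _).mpr hz
      refine ⟨Matrix.diagonal fun _ => z⁻¹, ?_, ?_⟩
      · rw [Matrix.det_diagonal, isUnit_iff_ne_zero]
        exact Finset.prod_ne_zero_iff.mpr fun _ _ => inv_ne_zero hz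
      · have hcT : cT L (Matrix.diagonal fun _ : ι => z⁻¹) = Matrix.diagonal fun _ => conjRingHomK L z⁻¹ := by
          simp [cT, Matrix.diagonal_transpose, Matrix.diagonal_map]
        rw [hcT, Matrix.diagonal_mul_diagonal, Matrix.diagonal_mul_diagonal]
        congr 1
        funext i
        rw [hi₀ i, hprod, map_inv₀]
        field_simp
    · -- rank `m + 2`
      obtain ⟨m, rfl⟩ : ∃ m, n = m + 1 := ⟨n - 1, by omega⟩
      obtain ⟨i₀⟩ : Nonempty ι := Fintype.card_pos_iff.mp (by omega)
      have hκ : Fintype.card {i // i ≠ i₀} = m + 1 := by rw [card_ne, hcard]; omega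
      let eκ : {i // i ≠ i₀} ⊕ Fin 1 ≃ ι := splitEquiv i₀
      have hc : conjRingHomK L (a i₀) = a i₀ := ha i₀
      have hc0 : a i₀ ≠ 0 := ha0 i₀
      have e4 : a ∘ eκ = Sum.elim (fun k : {i // i ≠ i₀} => a k.1) (fun _ : Fin 1 => a i₀) := by
        ext x; rcases x with k | j <;> simp [eκ]
      -- `a i₀` is compatible with `a' ∘ eκ` (signature equality forces it)
      have hcompat : RepCompat (a' ∘ eκ) (a i₀) := by
        intro τ
        constructor
        · intro hall
          have hall' : ∀ j, 0 < (τ (a' j)).re := fun j => by simpa using hall (eκ.symm j)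
          have h1 : posCount L τ a' = Fintype.card ι := (posCount_eq_card_iff L τ a').mpr hall'
          exact (posCount_eq_card_iff L τ a).mp ((hsig τ).trans h1) i₀
        · intro hall
          have hall' : ∀ j, ¬ 0 < (τ (a' j)).re := fun j => by simpa using hall (eκ.symm j)
          have h1 : posCount L τ a' = 0 := (posCount_eq_zero_iff L τ a').mpr hall'
          exact (posCount_eq_zero_iff L τ a).mp ((hsig τ).trans h1) i₀
      obtain ⟨d, hd, hd0, hrep⟩ :=
        rep_step m {i // i ≠ i₀} hκ (a' ∘ eκ) (a i₀) (fun x => ha' _) (fun x => ha'0 _) hc hc0 hcompat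
      -- the invariants descend to `(a k)_{k ≠ i₀}` versus `d`
      have hsig' : ∀ τ : L →+* ℂ, posCount L τ (fun k : {i // i ≠ i₀} => a k.1) = posCount L τ d := by
        intro τ
        have e1 := hrep.posCount_eq τ
        rw [posCount_sum_elim, posCount_comp_equiv] at e1
        have e3 := posCount_comp_equiv L τ a eκ
        rw [e4, posCount_sum_elim] at e3
        have e5 := hsig τ
        omega
      have hdisc' : ∃ w : L, w ≠ 0 ∧
          ∏ k : {i // i ≠ i₀}, a k.1 = (∏ k, d k) * (w * conjRingHomK L w) := by
        obtain ⟨z, hz, hz'⟩ := hdisc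
        obtain ⟨z₁, hz₁, hz₁'⟩ := hrep.disc
        refine ⟨z₁ * z, mul_ne_zero hz₁ hz, mul_right_cancel₀ hc0 ?_⟩
        have pa : ∏ i, a i = (∏ k : {i // i ≠ i₀}, a k.1) * a i₀ := by
          rw [← Fintype.prod_equiv eκ (a ∘ eκ) a (fun _ => rfl), e4, Fintype.prod_sum_type]
          simp
        have pa' : ∏ x, (a' ∘ eκ) x = ∏ i, a' i := Fintype.prod_equiv eκ (a' ∘ eκ) a' (fun _ => rfl)
        have pd : ∏ x, Sum.elim d (fun _ : Fin 1 => a i₀) x = (∏ k, d k) * a i₀ := by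
          rw [Fintype.prod_sum_type]; simp
        rw [pa', pd] at hz₁'
        rw [← pa, hz', hz₁', map_mul]
        ring
      have hκiso := ih {i // i ≠ i₀} hκ (fun k => a k.1) d (fun k => ha _) hd (fun k => ha0 _) hd0 hsig' hdisc'
      -- assemble:  a ∘ eκ = (a|_κ) ⊥ ⟨a i₀⟩ ≅ d ⊥ ⟨a i₀⟩ ≅ a' ∘ eκ
      have h4 : IsomDiag L (a ∘ eκ) (Sum.elim d fun _ : Fin 1 => a i₀) := by
        rw [e4]; exact hκiso.sum (IsomDiag.refl L _)
      exact IsomDiag.of_comp_equiv eκ (h4.trans hrep.symm)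

end Main

end LandherrRankN

/-! ## §6. Landherr's theorem for diagonal hermitian forms of rank `n` -/

variable (L : CMField)

open LandherrRankN in
/-- **Landherr's theorem [La36] for diagonal hermitian forms of arbitrary rank over a CM field** (Shimura 2008
Thm. 2.2 (i); the rank-2 case is `HodgeCM.Lemma33bLandherr` / `HodgeCM.Literature.landherr_rank2_iff`).
For `a, a' : ι → L₀^×` (`σ`-fixed, non-zero):  `diag a` and `diag a'` are `σ`-hermitian-congruent over `L`
iff they have the same positive index at every complex embedding of `L` and `∏ aᵢ / ∏ a'ᵢ` is a norm from `L`. -/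
theorem landherr_diagonal_iff {ι : Type} [Fintype ι] [DecidableEq ι] (a a' : ι → L)
    (ha : ∀ i, conjRingHomK L (a i) = a i) (ha' : ∀ i, conjRingHomK L (a' i) = a' i)
    (ha0 : ∀ i, a i ≠ 0) (ha'0 : ∀ i, a' i ≠ 0) :
    (∃ g : GL ι L,
      ((g : Matrix ι ι L).transpose.map (conjRingHomK L)) * Matrix.diagonal a * (g : Matrix ι ι L) =
        Matrix.diagonal a') ↔
    ((∀ τ : L →+* ℂ,
        (Finset.univ.filter fun i => 0 < (τ (a i)).re).card =
          (Finset.univ.filter fun i => 0 < (τ (a' i)).re).card) ∧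
      ∃ z : L, z ≠ 0 ∧ ∏ i, a i = (∏ i, a' i) * (z * conjRingHomK L z)) := by
  constructor
  · rintro ⟨g, hg⟩
    have h : IsomDiag L a a' := IsomDiag.of_gl g hg
    exact ⟨h.posCount_eq, h.disc⟩
  · rintro ⟨hsig, hdisc⟩
    exact (isomDiag_of_invariants (Fintype.card ι) ι rfl a a' ha ha' ha0 ha'0 hsig hdisc).exists_gl

/-- `HodgeCM.landherr_diagonal_iff` over `Fin n`: Landherr's theorem for diagonal hermitian forms of rank `n`. -/
theorem landherr_rank_iff (n : ℕ) (a a' : Fin n → L)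
    (ha : ∀ i, conjRingHomK L (a i) = a i) (ha' : ∀ i, conjRingHomK L (a' i) = a' i)
    (ha0 : ∀ i, a i ≠ 0) (ha'0 : ∀ i, a' i ≠ 0) :
    (∃ g : GL (Fin n) L,
      ((g : Matrix (Fin n) (Fin n) L).transpose.map (conjRingHomK L)) * Matrix.diagonal a *
        (g : Matrix (Fin n) (Fin n) L) = Matrix.diagonal a') ↔
    ((∀ τ : L →+* ℂ,
        (Finset.univ.filter fun i => 0 < (τ (a i)).re).card =
          (Finset.univ.filter fun i => 0 < (τ (a' i)).re).card) ∧
      ∃ z : L, z ≠ 0 ∧ ∏ i, a i = (∏ i, a' i) * (z * conjRingHomK L z)) :=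
  landherr_diagonal_iff L a a' ha ha' ha0 ha'0

/-- For planes, the positive-index condition is the sign-multiset condition of the typed target. -/
theorem LandherrRankN.card_filter_pos_two_iff (τ : L →+* ℂ) (x y x' y' : L) :
    (Finset.univ.filter fun i => 0 < (τ (![x, y] i)).re).card =
        (Finset.univ.filter fun i => 0 < (τ (![x', y'] i)).re).card ↔
      ({decide (0 < (τ x).re), decide (0 < (τ y).re)} : Multiset Bool) =
        {decide (0 < (τ x').re), decide (0 < (τ y').re)} := by
  rw [Finset.card_filter, Finset.card_filter, Fin.sum_univ_two, Fin.sum_univ_two]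
  simp only [Matrix.cons_val_zero, Matrix.cons_val_one]
  by_cases h1 : 0 < (τ x).re <;> by_cases h2 : 0 < (τ y).re <;> by_cases h3 : 0 < (τ x').re <;>
    by_cases h4 : 0 < (τ y').re <;> simp [h1, h2, h3, h4] <;> decide

/-- **Consistency with the rank-2 theorem.**  The case `n = 2` of `HodgeCM.landherr_rank_iff` is, word for word,
the statement of `HodgeCM.Literature.landherr_rank2_iff` (whose `→ ∃ g` half is the typed target
`HodgeCM.Lemma33bLandherr`); the `example` below records that the two agree. -/
theorem landherr_rank2_iff_of_rankN (a : Fin 4 → L) (ha : ∀ i, conjRingHomK L (a i) = a i)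
    (ha0 : ∀ i, a i ≠ 0) :
    (∃ g : GL (Fin 2) L,
      ((g : Matrix (Fin 2) (Fin 2) L).transpose.map (conjRingHomK L)) * Matrix.diagonal ![a 0, a 1] *
        (g : Matrix (Fin 2) (Fin 2) L) = Matrix.diagonal ![a 2, a 3]) ↔
    ((∀ τ : L →+* ℂ,
      ({decide (0 < (τ (a 0)).re), decide (0 < (τ (a 1)).re)} : Multiset Bool) =
        {decide (0 < (τ (a 2)).re), decide (0 < (τ (a 3)).re)}) ∧
    ∃ z : L, z ≠ 0 ∧ a 0 * a 1 = a 2 * a 3 * (z * conjRingHomK L z)) := by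
  rw [landherr_rank_iff L 2 ![a 0, a 1] ![a 2, a 3]
    (by intro i; fin_cases i <;> simp [ha]) (by intro i; fin_cases i <;> simp [ha])
    (by intro i; fin_cases i <;> simp [ha0]) (by intro i; fin_cases i <;> simp [ha0])]
  simp only [LandherrRankN.card_filter_pos_two_iff, Fin.prod_univ_two, Matrix.cons_val_zero, Matrix.cons_val_one]

example (a : Fin 4 → L) (ha : ∀ i, conjRingHomK L (a i) = a i) (ha0 : ∀ i, a i ≠ 0) :=
  (landherr_rank2_iff_of_rankN L a ha ha0).trans (Literature.landherr_rank2_iff L a ha ha0).symm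

end HodgeCM

end
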